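import Summits.BirchSwinnertonDyer.BirchSwinnertonDyer.Theorems.KimAtThreeFineKatoKPortUnitTrace
import Literature.NumberTheory.EllipticCurves.ReductionHomomorphismSurjectiveProofs
import Literature.NumberTheory.EllipticCurves.SingularCubic
import Literature.NumberTheory.EllipticCurves.VariableChangePointsMap
import HarnessLib

/-!
# K-PORT glue (toward `hres`, steps r1/r2/r4): the `k`-RATIONAL CUSP CHART `r : E₀(K) ↠ k⁺` of an
# additively reducing `E = M ⊗ K` — kernel `E₁(K)`, onto, and GALOIS-EQUIVARIANT
# (cell `bsd-addord`, seat w2-kport gen 2; `--supports stmt-BirchSwinnertonDyer-19560`, helper)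

HONEST FRAMING. Route W2 (`route-BirchSwinnertonDyer-KimAtThreeKolyvagin`), crux 19560
`KatoKuriharaPortThreeShared`, residual ⟨C1⟩ clause (C1.c), hypothesis `hres` of gen 0's
`KPort.consumer_of_exists_norm_not_mem_kernel`: `∃ P ∈ E₀(K), N(P) = ∑_σ σP ∉ E₁(K)`. This file
supplies the reduction-side inputs (inventory HOME/kport/KPORT-INVENTORY-g0.md §6, r1/r2/r4) in the
port's currency (`𝒪 = unitBall K`, `M_K = M.map (coeffHom p K)`, `E = curveK p K M = M_K ⊗ K`,
`E₀(K) = M_K.nonsingularReductionSubgroup hv`, reduced cubic `Ṽ = M_K.map (residue 𝒪)` over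
`k = 𝒪/𝔪`), WITHOUT introducing any definition: GIVEN cusp data `x₀, y₀, α ∈ ℤ_p` with
`Ṽ = singularModel x̄₀ ȳ₀ ᾱ ᾱ` (hypothesis `hV`; discharged at `p = 3` from `Δ, c₄ ∈ pℤ_p` in
`…KPortCuspThree`), the chart is the composite of tree maps

  `r = singularModel.cuspHom x̄₀ ȳ₀ ᾱ ∘ Affine.Point.congrEquiv hV ∘ reducePoint`
  (`SingularCubic`: Silverman III.2.5(b) `(x, y) ↦ (x − x₀)/(y − y₀ − α(x − x₀))`; `VariableChangePointsMap`;
   `ReductionHomomorphism`),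

and we prove: its value on an integral point (`cuspChart_some`), that it kills exactly `E₁(K)`
(`cuspChart_reducePoint_eq_zero_iff`), that it is ONTO (`exists_mem_nonsingularReductionSubgroup_cuspChart_eq`,
from the tree's `exists_reducePoint_eq` over the HENSELIAN `𝒪_K` of `…KPortResidueField` and
`cuspHom_surjective`), and that it is `Gal(K/ℚ_p)`-EQUIVARIANT in the def-free form "`r(P̃) = ā ⇒
r((σP)~) = (σa)‾`" (`cuspChart_reducePoint_galois`: `σ` acts on coordinates, reduction is coordinatewise,
the chart is a rational function over `𝔽_p`). TOOL theorems only (no definition, no named fact, no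
`sorry`); closes nothing by itself; nothing booked. The assembly of `hres` is `…KPortConsumerHolds`.

References: J. H. Silverman, *The Arithmetic of Elliptic Curves*, 2nd ed. (2009), III.2.5, VII.2.1,
VII.5 [SilvermanAEC2009]; kim3 brief HOME/kim3/KIM3-KPORT-BRIEF-g12.md §3 (P3).
-/

noncomputable section

-- the cell's Theorems namespace `Summit.BirchSwinnertonDyer.BirchSwinnertonDyer.…` repeats the summit name by design (D-0017)
set_option linter.dupNamespace false

open scoped Classical NNReal

namespace Summit.BirchSwinnertonDyer.BirchSwinnertonDyer.Theorems.KPort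

open Summit.BirchSwinnertonDyer.Rank1Residual.Additive.BallEval
open Literature.NumberTheory.GaloisRepresentations.LubinTate (unitBall mem_unitBall_iff)
open Literature.NumberTheory.EllipticCurves
open WeierstrassCurve

variable {p : ℕ} [hp : Fact p.Prime] {K : Type*} [NontriviallyNormedField K] [NormedAlgebra ℚ_[p] K]
  [IsUltrametricDist K] {M : WeierstrassCurve ℤ_[p]}

/-! ## §1 Reduction of an integral point in the `curveK` currency -/

section Reduce

/-- An affine point `(x, y)` of `E = M_K ⊗ K` with `‖x‖ ≤ 1` has `‖y‖ ≤ 1`. [cite: SilvermanAEC2009, VII.2 Prop. 2.1] -/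
theorem norm_Y_le_one_of_norm_X_le_one {x y : K} (h : (curveK p K M).toAffine.Nonsingular x y)
    (hx : ‖x‖ ≤ 1) : ‖y‖ ≤ 1 := by
  have hv := Valuation.integer.integers (NormedField.valuation (K := K))
  have hx' : NormedField.valuation (K := K) x ≤ 1 := by
    rw [← NNReal.coe_le_coe, NormedField.valuation_apply, coe_nnnorm, NNReal.coe_one]; exact hx
  have hy := v_Y_le_one_of_v_X_le_one (W := M.map (coeffHom p K)) hv h.1 hx'
  rw [← NNReal.coe_le_coe, NormedField.valuation_apply, coe_nnnorm, NNReal.coe_one] at hy; exact hy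

/-- `(x, y) ∈ E₀(K)` with `‖x‖ ≤ 1` has NONSINGULAR residue `(x̄, ȳ)` on `Ṽ`. [cite: SilvermanAEC2009, VII.2 Prop. 2.1] -/
theorem nonsingular_residue_of_mem {x y : K} (h : (curveK p K M).toAffine.Nonsingular x y) (hx : ‖x‖ ≤ 1)
    (hP : (Affine.Point.some x y h : (curveK p K M).toAffine.Point) ∈
      (M.map (coeffHom p K)).nonsingularReductionSubgroup
        (Valuation.integer.integers (NormedField.valuation (K := K)))) :
    ((M.map (coeffHom p K)).map (IsLocalRing.residue (unitBall K))).toAffine.Nonsingular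
      (IsLocalRing.residue (unitBall K) ⟨x, (mem_unitBall_iff K).mpr hx⟩)
      (IsLocalRing.residue (unitBall K) ⟨y, (mem_unitBall_iff K).mpr (norm_Y_le_one_of_norm_X_le_one h hx)⟩) := by
  have hv := Valuation.integer.integers (NormedField.valuation (K := K))
  have h' : ((M.map (coeffHom p K)).baseChange K).toAffine.Nonsingular
      (algebraMap (unitBall K) K ⟨x, (mem_unitBall_iff K).mpr hx⟩)
      (algebraMap (unitBall K) K ⟨y, (mem_unitBall_iff K).mpr (norm_Y_le_one_of_norm_X_le_one h hx)⟩) := h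
  have hP' : (M.map (coeffHom p K)).HasNonsingularReduction (.some _ _ h') := hP
  exact (hasNonsingularReduction_some_algebraMap_iff hv.hom_inj h').mp hP'

/-- **Reduction is coordinatewise**: for `(x, y) ∈ E₀(K)` with `‖x‖ ≤ 1`, `(x, y)~ = (x̄, ȳ)`.
[cite: SilvermanAEC2009, VII.2 Prop. 2.1] -/
theorem reducePoint_some_of_norm_le_one {x y : K} (h : (curveK p K M).toAffine.Nonsingular x y)
    (hx : ‖x‖ ≤ 1)
    (hP : (Affine.Point.some x y h : (curveK p K M).toAffine.Point) ∈
      (M.map (coeffHom p K)).nonsingularReductionSubgroup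
        (Valuation.integer.integers (NormedField.valuation (K := K)))) :
    (M.map (coeffHom p K)).reducePoint (Affine.Point.some x y h : (curveK p K M).toAffine.Point) =
      .some (IsLocalRing.residue (unitBall K) ⟨x, (mem_unitBall_iff K).mpr hx⟩)
        (IsLocalRing.residue (unitBall K) ⟨y, (mem_unitBall_iff K).mpr (norm_Y_le_one_of_norm_X_le_one h hx)⟩)
        (nonsingular_residue_of_mem h hx hP) := by
  have hv := Valuation.integer.integers (NormedField.valuation (K := K))
  have h' : ((M.map (coeffHom p K)).baseChange K).toAffine.Nonsingular
      (algebraMap (unitBall K) K ⟨x, (mem_unitBall_iff K).mpr hx⟩)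
      (algebraMap (unitBall K) K ⟨y, (mem_unitBall_iff K).mpr (norm_Y_le_one_of_norm_X_le_one h hx)⟩) := h
  change (M.map (coeffHom p K)).reducePoint (.some _ _ h') = _
  exact reducePoint_some_algebraMap hv.hom_inj h' (nonsingular_residue_of_mem h hx hP)

/-- A point `(x, y)` with `1 < ‖x‖` reduces to `Õ`. [cite: SilvermanAEC2009, VII.2 Prop. 2.1] -/
theorem reducePoint_some_of_one_lt_norm {x y : K} (h : (curveK p K M).toAffine.Nonsingular x y)
    (hx : 1 < ‖x‖) :
    (M.map (coeffHom p K)).reducePoint (Affine.Point.some x y h : (curveK p K M).toAffine.Point) = 0 := by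
  have hv := Valuation.integer.integers (NormedField.valuation (K := K))
  have h' : ((M.map (coeffHom p K)).baseChange K).toAffine.Nonsingular x y := h
  have hx' : 1 < NormedField.valuation (K := K) x := by
    rw [← NNReal.coe_lt_coe, NormedField.valuation_apply, coe_nnnorm, NNReal.coe_one]; exact hx
  change (M.map (coeffHom p K)).reducePoint (.some x y h') = 0
  exact reducePoint_some_of_not_mem h' ((not_mem_range_iff hv).mpr hx')

end Reduce

/-! ## §2 The cusp chart `r = cuspHom ∘ congrEquiv hV ∘ reducePoint`: values, kernel, surjectivity -/

section Chart

variable {x₀ y₀ α : ℤ_[p]}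
  (hV : (M.map (coeffHom p K)).map (IsLocalRing.residue (unitBall K)) =
    singularModel (IsLocalRing.residue (unitBall K) (coeffHom p K x₀))
      (IsLocalRing.residue (unitBall K) (coeffHom p K y₀))
      (IsLocalRing.residue (unitBall K) (coeffHom p K α)) (IsLocalRing.residue (unitBall K) (coeffHom p K α)))
include hV

/-- The chart on an affine point of `Ṽ`: Silverman's `(X − x̄₀)/(Y − ȳ₀ − ᾱ(X − x̄₀))`.
[cite: SilvermanAEC2009, III.2.5(b)] -/
theorem cuspChart_some {X Y : IsLocalRing.ResidueField (unitBall K)}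
    (hXY : ((M.map (coeffHom p K)).map (IsLocalRing.residue (unitBall K))).toAffine.Nonsingular X Y) :
    singularModel.cuspHom _ _ _ (Affine.Point.congrEquiv hV (.some X Y hXY)) =
      (X - IsLocalRing.residue (unitBall K) (coeffHom p K x₀)) /
        (Y - IsLocalRing.residue (unitBall K) (coeffHom p K y₀) -
          IsLocalRing.residue (unitBall K) (coeffHom p K α) * (X - IsLocalRing.residue (unitBall K) (coeffHom p K x₀))) := by
  rw [Affine.Point.congrEquiv_some, singularModel.cuspHom_apply]
  rfl

/-- The chart vanishes exactly at `Õ`. [cite: SilvermanAEC2009, III.2.5(b)] -/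
theorem cuspChart_eq_zero_iff (Q : ((M.map (coeffHom p K)).map (IsLocalRing.residue (unitBall K))).toAffine.Point) :
    singularModel.cuspHom _ _ _ (Affine.Point.congrEquiv hV Q) = 0 ↔ Q = 0 := by
  rw [← map_zero (singularModel.cuspHom _ _ _), singularModel.cuspHom_injective.eq_iff,
    ← map_zero (Affine.Point.congrEquiv hV), (Affine.Point.congrEquiv hV).injective.eq_iff]

/-- The chart on reductions kills exactly `E₁(K)`: for `P ∈ E₀(K)`, `r(P̃) = 0 ↔ P ∈ E₁(K)`.
[cite: SilvermanAEC2009, VII.2 Prop. 2.1 and III.2.5(b)] -/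
theorem cuspChart_reducePoint_eq_zero_iff {P : (curveK p K M).toAffine.Point}
    (hP : P ∈ (M.map (coeffHom p K)).nonsingularReductionSubgroup
      (Valuation.integer.integers (NormedField.valuation (K := K)))) :
    singularModel.cuspHom _ _ _ (Affine.Point.congrEquiv hV ((M.map (coeffHom p K)).reducePoint P)) = 0 ↔
      (M.map (coeffHom p K)).ReducesToZero P := by
  rw [cuspChart_eq_zero_iff hV]
  exact reducePoint_eq_zero_iff (Valuation.integer.integers (NormedField.valuation (K := K))) hP

/-- **The chart is onto**: every `ā ∈ k` is `r(P̃)` for some `P ∈ E₀(K)` (Hensel: `𝒪_K` is henselian for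
`K/ℚ_p` finite, tree `exists_reducePoint_eq`; and `cuspHom` is onto). [cite: SilvermanAEC2009, VII.2 Prop. 2.1 and III.2.5(b)] -/
theorem exists_mem_nonsingularReductionSubgroup_cuspChart_eq [FiniteDimensional ℚ_[p] K]
    (ω : IsLocalRing.ResidueField (unitBall K)) :
    ∃ P ∈ (M.map (coeffHom p K)).nonsingularReductionSubgroup
        (Valuation.integer.integers (NormedField.valuation (K := K))),
      singularModel.cuspHom _ _ _ (Affine.Point.congrEquiv hV ((M.map (coeffHom p K)).reducePoint P)) = ω := by
  haveI := henselianRing_unitBall p K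
  have hv := Valuation.integer.integers (NormedField.valuation (K := K))
  obtain ⟨T, hT⟩ := singularModel.cuspHom_surjective
    (x₀ := IsLocalRing.residue (unitBall K) (coeffHom p K x₀))
    (y₀ := IsLocalRing.residue (unitBall K) (coeffHom p K y₀))
    (α := IsLocalRing.residue (unitBall K) (coeffHom p K α)) ω
  obtain ⟨P, hP, hPQ⟩ := (M.map (coeffHom p K)).exists_reducePoint_eq (K := K) hv.hom_inj
    ((Affine.Point.congrEquiv hV).symm T)
  refine ⟨P, hP, ?_⟩
  rw [hPQ, AddEquiv.apply_symm_apply, hT]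

end Chart

/-! ## §3 Galois-equivariance of the chart -/

section Galois

variable {x₀ y₀ α : ℤ_[p]}
  (hV : (M.map (coeffHom p K)).map (IsLocalRing.residue (unitBall K)) =
    singularModel (IsLocalRing.residue (unitBall K) (coeffHom p K x₀))
      (IsLocalRing.residue (unitBall K) (coeffHom p K y₀))
      (IsLocalRing.residue (unitBall K) (coeffHom p K α)) (IsLocalRing.residue (unitBall K) (coeffHom p K α)))
include hV

/-- **The cusp chart is `Gal(K/ℚ_p)`-equivariant** (`K/ℚ_p` algebraic, e.g. finite): if `P ∈ E₀(K)`
reduces to chart value `ā` (`a ∈ 𝒪_K`), then `σP` reduces to chart value `(σa)‾`. Reduction is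
coordinatewise, `σ` is an isometry fixing `ℚ_p`, and the chart is a rational function with
coefficients `x̄₀, ȳ₀, ᾱ` coming from `ℤ_p`. [cite: SilvermanAEC2009, VII.2 Prop. 2.1 and III.2.5(b)] -/
theorem cuspChart_reducePoint_galois [Algebra.IsAlgebraic ℚ_[p] K] (σ : K ≃ₐ[ℚ_[p]] K)
    {P : (curveK p K M).toAffine.Point}
    (hP : P ∈ (M.map (coeffHom p K)).nonsingularReductionSubgroup
      (Valuation.integer.integers (NormedField.valuation (K := K))))
    {a : K} (ha : ‖a‖ ≤ 1)
    (hPa : singularModel.cuspHom _ _ _ (Affine.Point.congrEquiv hV ((M.map (coeffHom p K)).reducePoint P)) =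
      IsLocalRing.residue (unitBall K) ⟨a, (mem_unitBall_iff K).mpr ha⟩) :
    singularModel.cuspHom _ _ _ (Affine.Point.congrEquiv hV ((M.map (coeffHom p K)).reducePoint
        (Affine.Point.map (W' := (M.map PadicInt.Coe.ringHom).toAffine) (σ : K →ₐ[ℚ_[p]] K) P))) =
      IsLocalRing.residue (unitBall K) ⟨σ a, (mem_unitBall_iff K).mpr (norm_galois_le_one σ ha)⟩ := by
  -- `σ|_𝒪` and `σ̄`
  let σO : unitBall K →+* unitBall K :=
    ((σ : K →+* K).comp (unitBall K).subtype).codRestrict (unitBall K) fun b =>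
      (mem_unitBall_iff K).mpr (norm_galois_le_one σ ((mem_unitBall_iff K).mp b.2))
  have σO_coe : ∀ b : unitBall K, ((σO b : unitBall K) : K) = σ b := fun b => rfl
  haveI hloc : IsLocalHom σO :=
    ⟨fun b hb => by
      rw [isUnit_unitBall_iff_norm_eq_one] at hb ⊢
      rw [σO_coe, norm_algEquiv_eq] at hb
      exact hb⟩
  let σk : IsLocalRing.ResidueField (unitBall K) →+* IsLocalRing.ResidueField (unitBall K) :=
    IsLocalRing.ResidueField.map σO
  have σk_apply : ∀ b : unitBall K, σk (IsLocalRing.residue (unitBall K) b) =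
      IsLocalRing.residue (unitBall K) (σO b) := fun b => rfl
  have σk_coeff : ∀ z : ℤ_[p], σk (IsLocalRing.residue (unitBall K) (coeffHom p K z)) =
      IsLocalRing.residue (unitBall K) (coeffHom p K z) := fun z => by
    rw [σk_apply]; congr 1; apply Subtype.ext
    rw [σO_coe, coe_coeffHom, AlgEquiv.commutes]
  have hσa : IsLocalRing.residue (unitBall K) ⟨σ a, (mem_unitBall_iff K).mpr (norm_galois_le_one σ ha)⟩ =
      σk (IsLocalRing.residue (unitBall K) ⟨a, (mem_unitBall_iff K).mpr ha⟩) := by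
    rw [σk_apply]; rfl
  rw [hσa, ← hPa]
  rcases P with _ | ⟨x, y, h⟩
  · -- `P = O`
    change singularModel.cuspHom _ _ _ (Affine.Point.congrEquiv hV ((M.map (coeffHom p K)).reducePoint 0)) =
      σk (singularModel.cuspHom _ _ _ (Affine.Point.congrEquiv hV ((M.map (coeffHom p K)).reducePoint 0)))
    rw [WeierstrassCurve.reducePoint_zero, map_zero, map_zero, map_zero]
  · obtain ⟨hσ', hmap⟩ : ∃ hσ' : (curveK p K M).toAffine.Nonsingular (σ x) (σ y),
        Affine.Point.map (W' := (M.map PadicInt.Coe.ringHom).toAffine) (σ : K →ₐ[ℚ_[p]] K)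
          (Affine.Point.some x y h : (curveK p K M).toAffine.Point) = Affine.Point.some (σ x) (σ y) hσ' :=
      ⟨_, rfl⟩
    rw [hmap]
    by_cases hx : ‖x‖ ≤ 1
    · -- integral point: reduction is coordinatewise, the chart is a rational function over `𝔽_p`
      have hσP := (galois_mem_nonsingularReductionSubgroup_iff (M := M) σ (.some x y h)).mpr hP
      rw [hmap] at hσP
      have hσx : ‖σ x‖ ≤ 1 := norm_galois_le_one σ hx
      rw [reducePoint_some_of_norm_le_one hσ' hσx hσP, reducePoint_some_of_norm_le_one h hx hP,
        cuspChart_some hV, cuspChart_some hV]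
      simp only [map_div₀, map_sub, map_mul, σk_coeff, σk_apply]
      rfl
    · -- `P ∈ E₁(K)`: both sides are the chart of `Õ`
      rw [not_le] at hx
      have hσx : 1 < ‖σ x‖ := by rw [norm_algEquiv_eq]; exact hx
      rw [reducePoint_some_of_one_lt_norm hσ' hσx, reducePoint_some_of_one_lt_norm h hx, map_zero, map_zero, map_zero]

end Galois

end Summit.BirchSwinnertonDyer.BirchSwinnertonDyer.Theorems.KPort

end
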